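import Literature.Analysis.FluidPDE.LocalLerayInitialEnergyGradient
import Literature.Analysis.FluidPDE.LocalLeraySlabCubicIntegrability
import HarnessLib

/-!
# Jia–Šverák 2014, towards Thm. 3.2: the local energy inequality from `t = 0` with the
  dissipation, for local Leray solutions **on a slab** `(0, T) × ℝ³`

Analysis/FluidPDE proofs file (theorems only, no new definitions, no new named facts), part of
the proof of the named fact `Literature.Analysis.FluidPDE.jia_sverak_2014_theorem_3_2`
(`JiaSverak2014LocalRegularity.lean`; H. Jia, V. Šverák, Invent. Math. 196 (2014) =
arXiv:1204.0529, §3 Thm. 3.2). The printed proof of Thm. 3.1/3.2 (arXiv p. 8: "Since `u`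
satisfies the local energy inequality and `a` is regular […] we can derive the local energy
inequality for `v`") and of its input Lemma 3.1 (= Jia–Šverák 2013, Lemma 2, "use the definition
of Leray solution, the local energy inequality") both start from the local energy inequality of
the Leray solution **from the initial time**, tested with a time-independent weight `ψ(x) ≥ 0`:

  `∫|v(s)|²ψ + 2∫∫_{(0,s)×B_r} |∇v|²ψ ≤ ∫|v₀|²ψ + ∫∫_{(0,s)×B_r} | |v|²Δψ + (|v|² + 2π) v·∇ψ |`

for a.e. `s` (Seregin 2014, Remark B.3, (B.1.10) with `t₀ = 0`; Lemarié-Rieusset 2016,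
Prop. 14.1). The tree proves this for Jia–Šverák's *global-in-time* class
(`IsLocalLeraySolution.ae_lintegral_sq_mul_add_grad_le_datum_add`,
`LocalLerayInitialEnergyGradient.lean`); the fact `jia_sverak_2014_theorem_3_2` is stated over
the finite-slab class `IsLocalLeraySolutionOn T 1 v₀ v π` (Lemarié-Rieusset 2016, Def. 14.1),
so this file records the same inequality for the slab class:

* `ae_lintegral_sq_mul_add_grad_le_datum_add_of_suitable` — the inequality from the raw
  hypotheses the tree's proof actually uses: `(v, π)` suitable (CKN) on the cylinder
  `(0,T₀) × B_r` with a weak spatial gradient `G` there, `v` measurable and square integrable on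
  the finite cylinders `(0,T₀) × K` up to `t = 0`, `v(t) → v₀` in `L²_loc`, `v₀` measurable,
  `|v|³ ∈ L¹((0,T₀) × B_r)`, for a.e. `s ∈ (0, τ)`, any `τ < T₀`; the proof is the tree's,
  verbatim up to the position of the top plateau (the accepted sliced inequality
  `IsSuitableWeakSolutionOn.ae_localEnergy_slice_ennreal`, CKN (2.5), tested with
  `η_δ(t) θ(t) ψ(x)`, `θ ≡ 1` on `[-1, τ₁]`, `τ < τ₁ < T₀`, and `δ → 0` through the initial
  condition; the dissipation integrals over `[3δ_m, s) × B_r` increase to the one over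
  `(0,s) × B_r`);
* `IsLocalLeraySolutionOn.ae_lintegral_sq_mul_add_grad_le_datum_add` — the inequality for a
  local Leray solution on the slab `(0,T) × ℝ³`, for a.e. `s ∈ (0, T₀)`, any `0 < T₀ ≤ T` — so up
  to the final time of the slab (the cubic integrability on `(0,T) × B_r` is the tree's
  `IsLocalLeraySolutionOn.lintegral_cube_box_lt_top`; the horizons `τ_k = T₀ - T₀/(k+2) ↑ T₀`
  exhaust `(0, T₀)`).

## Mathlib / tree search

Tree: `IsLocalLeraySolution.ae_lintegral_sq_mul_add_grad_le_datum_add` (global class only;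
`lean search 'grad_le_datum_add|datum_add.*On'`), the generic slab tools
`integrableOn_cylinder_of_lintegral_sq_slab`, `ae_slice_aestronglyMeasurable_and_lintegral_ball_lt_top`,
`lintegral_datum_sq_lt_top`, `exists_ae_abs_integral_sq_mul_sub_le`, `exists_smooth_time_cutoff`,
`tendsto_setIntegral_mul_of_ae_tendsto` (`LocalLerayInitialPairing/Energy`),
`IsSuitableWeakSolutionOn.ae_localEnergy_slice_ennreal`, `localEnergyRHS_mul_of_hasDerivAt`
(`SuitableWeakSliced`), `IsLocalLeraySolutionOn.lintegral_cube_box_lt_top`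
(`LocalLeraySlabCubicIntegrability`). Mathlib: `setLIntegral_iUnion_of_directed`, `ContDiffBump`.

## References

* H. Jia, V. Šverák, Invent. Math. 196 (2014) 233–265 = arXiv:1204.0529, §3: Def. 3.1,
  Lemma 3.1, proof of Thm. 3.1 (p. 8). Bib key `JiaSverak2014`.
* G. Seregin, *Lecture notes on regularity theory for the Navier–Stokes equations* (2014),
  App. B, Remark B.3, (B.1.10). Bib key `Seregin2014Notes`.
* P. G. Lemarié-Rieusset, *The Navier–Stokes Problem in the 21st Century* (2016), Def. 14.1,
  Prop. 14.1. Bib key `LemarieRieusset2016`.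
* L. Caffarelli, R. Kohn, L. Nirenberg, Comm. Pure Appl. Math. 35 (1982), §2 (2.5).
  Bib key `CaffarelliKohnNirenberg1982`.
-/

noncomputable section

open MeasureTheory TopologicalSpace Set Function Filter Metric
open _root_.Topology
open scoped ENNReal NNReal RealInnerProductSpace Laplacian

namespace Literature.Analysis.FluidPDE

open BradshawTsai2019

namespace JiaSverak2014

/-- **The local energy inequality from the initial time with the dissipation, at a.e. slice,
from the raw hypotheses** (Seregin 2014, Remark B.3, (B.1.10) with `t₀ = 0`; Lemarié-Rieusset
2016, Prop. 14.1; the step "since `u` satisfies the local energy inequality" of Jia–Šverák 2014,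
proof of Thm. 3.1, p. 8). Let `(v, π)` be a suitable weak solution (`ν = 1`, no force) on the
cylinder `Q = (0,T₀) × B_r` with weak spatial gradient `G` there; assume `v` is measurable on
`(0,T₀) × ℝ³` and square integrable on `(0,T₀) × K` for every compact `K`, `v(t) → v₀` in `L²(K)`
as `t → 0⁺`, `v₀` measurable, and `|v|³ ∈ L¹(Q)`. Then for every smooth `ψ ≥ 0` with
`tsupport ψ ⊆ B_r`, every `0 < τ < T₀` and a.e. `s ∈ (0, τ)`,
`∫ |v(s)|² ψ + 2 ∫∫_{(0,s)×B_r} |G|² ψ ≤ ∫ |v₀|² ψ + ∫∫_{(0,s)×B_r} | |v|² Δψ + (|v|² + 2π) v·∇ψ |`.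
The proof is the tree's proof of `IsLocalLeraySolution.ae_lintegral_sq_mul_add_grad_le_datum_add`
(which used the global class only to produce these hypotheses), verbatim except that the top
plateau `θ ≡ 1` sits on `[-1, τ₁]`, `τ₁ = τ + (T₀ - τ)/3`, instead of `[-1, 5T₀/8]`.
[cite: Seregin2014Notes, App. B Remark B.3 (B.1.10); LemarieRieusset2016 Prop. 14.1] -/
theorem ae_lintegral_sq_mul_add_grad_le_datum_add_of_suitable
    {v₀ : (EuclideanSpace ℝ (Fin 3)) → (EuclideanSpace ℝ (Fin 3))} {v : ℝ → (EuclideanSpace ℝ (Fin 3)) → (EuclideanSpace ℝ (Fin 3))} {π : ℝ → (EuclideanSpace ℝ (Fin 3)) → ℝ}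
    {r T₀ : ℝ} (hT₀ : 0 < T₀) (hm₀ : AEStronglyMeasurable v₀ volume)
    (hsuit : IsSuitableWeakSolutionOn
      (⟨Ioo 0 T₀ ×ˢ ball (0 : (EuclideanSpace ℝ (Fin 3))) r, isOpen_Ioo.prod isOpen_ball⟩ :
        Opens (ℝ × (EuclideanSpace ℝ (Fin 3)))) 1 0 v π)
    {G : ℝ → (EuclideanSpace ℝ (Fin 3)) → (EuclideanSpace ℝ (Fin 3)) →L[ℝ] (EuclideanSpace ℝ (Fin 3))}
    (hGQ : HasWeakSpatialGradientOn
      (⟨Ioo 0 T₀ ×ˢ ball (0 : (EuclideanSpace ℝ (Fin 3))) r, isOpen_Ioo.prod isOpen_ball⟩ :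
        Opens (ℝ × (EuclideanSpace ℝ (Fin 3)))) v G)
    (hmeas : AEStronglyMeasurable (uncurry v)
      ((volume : Measure (ℝ × (EuclideanSpace ℝ (Fin 3)))).restrict (Ioo 0 T₀ ×ˢ univ)))
    (hsq : ∀ K' : Set (EuclideanSpace ℝ (Fin 3)), IsCompact K' →
      ∫⁻ z in Ioo 0 T₀ ×ˢ K', ‖uncurry v z‖ₑ ^ 2 < ∞)
    (hinit : ∀ K' : Set (EuclideanSpace ℝ (Fin 3)), IsCompact K' →
      Tendsto (fun t => ∫⁻ x in K', ‖v t x - v₀ x‖ₑ ^ 2) (𝓝[>] 0) (𝓝 0))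
    (hu3 : IntegrableOn (fun z : ℝ × (EuclideanSpace ℝ (Fin 3)) => ‖v z.1 z.2‖ ^ 3) (Ioo 0 T₀ ×ˢ ball (0 : (EuclideanSpace ℝ (Fin 3))) r) volume)
    {ψ : (EuclideanSpace ℝ (Fin 3)) → ℝ} (hψ : ContDiff ℝ (⊤ : ℕ∞) ψ) (hψs : tsupport ψ ⊆ ball 0 r)
    (hψ0 : ∀ x, 0 ≤ ψ x) {τ : ℝ} (hτ0 : 0 < τ) (hτ : τ < T₀) :
    ∀ᵐ s ∂(volume.restrict (Ioo 0 τ)),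
      (∫⁻ x, ‖v s x‖ₑ ^ 2 * ENNReal.ofReal (ψ x)) +
          2 * ∫⁻ z in Ioo 0 s ×ˢ ball (0 : (EuclideanSpace ℝ (Fin 3))) r,
            ENNReal.ofReal (frobeniusNormSq (G z.1 z.2)) * ENNReal.ofReal (ψ z.2) ≤
        (∫⁻ x, ‖v₀ x‖ₑ ^ 2 * ENNReal.ofReal (ψ x)) +
        ∫⁻ z in Ioo 0 s ×ˢ ball (0 : (EuclideanSpace ℝ (Fin 3))) r,
          ‖‖v z.1 z.2‖ ^ 2 * Δ ψ z.2 +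
            (‖v z.1 z.2‖ ^ 2 + 2 * π z.1 z.2) * ⟪v z.1 z.2, gradient ψ z.2⟫‖ₑ := by
  -- the flux integrand
  set R₀ : ℝ × (EuclideanSpace ℝ (Fin 3)) → ℝ := fun z => ‖v z.1 z.2‖ ^ 2 * Δ ψ z.2 +
    (‖v z.1 z.2‖ ^ 2 + 2 * π z.1 z.2) * ⟪v z.1 z.2, gradient ψ z.2⟫ with hR₀
  -- the compact shadow of `ψ`
  set K : Set (EuclideanSpace ℝ (Fin 3)) := closedBall 0 r with hKdef
  have hK : IsCompact K := isCompact_closedBall 0 r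
  have hψK : ∀ x, x ∉ K → ψ x = 0 := fun x hx =>
    image_eq_zero_of_notMem_tsupport fun h' => hx (ball_subset_closedBall (hψs h'))
  have hψcs : HasCompactSupport ψ := HasCompactSupport.intro hK hψK
  obtain ⟨Cψ, hCψ⟩ := hψ.continuous.bounded_above_of_compact_support hψcs
  have hψC : ∀ x, ψ x ≤ Cψ := fun x => (le_abs_self _).trans (by simpa using hCψ x)
  have hψ2 : ContDiff ℝ 2 ψ := contDiff_infty.1 hψ 2
  have hψd : Differentiable ℝ ψ := hψ.differentiable (by simp)
  have hΔ0 : ∀ x, x ∉ ball (0 : (EuclideanSpace ℝ (Fin 3))) r → Δ ψ x = 0 := fun x hx =>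
    laplacian_eq_zero_of_notMem_tsupport fun h' => hx (hψs h')
  have hgrad0 : ∀ x, x ∉ ball (0 : (EuclideanSpace ℝ (Fin 3))) r → gradient ψ x = 0 := fun x hx => by
    have : fderiv ℝ ψ x = 0 := fderiv_of_notMem_tsupport ℝ fun h' => hx (hψs h')
    simp [gradient, this]
  have hR₀0 : ∀ z : ℝ × (EuclideanSpace ℝ (Fin 3)), z.2 ∉ ball (0 : (EuclideanSpace ℝ (Fin 3))) r → R₀ z = 0 := fun z hz => by
    simp only [hR₀, hΔ0 z.2 hz, hgrad0 z.2 hz, inner_zero_right, mul_zero, add_zero]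
  -- the region `Q = (0,T₀) × B_r`
  let Q : Opens (ℝ × (EuclideanSpace ℝ (Fin 3))) := ⟨Ioo 0 T₀ ×ˢ ball (0 : (EuclideanSpace ℝ (Fin 3))) r, isOpen_Ioo.prod isOpen_ball⟩
  change IsSuitableWeakSolutionOn Q 1 0 v π at hsuit
  change HasWeakSpatialGradientOn Q v G at hGQ
  have hu3' : LocallyIntegrableOn (fun z : ℝ × (EuclideanSpace ℝ (Fin 3)) => ‖v z.1 z.2‖ ^ 3) (Q : Set (ℝ × (EuclideanSpace ℝ (Fin 3))))
      volume := hu3.locallyIntegrableOn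
  have hfu : LocallyIntegrableOn (fun z : ℝ × (EuclideanSpace ℝ (Fin 3)) => ⟪(0 : ℝ → (EuclideanSpace ℝ (Fin 3)) → (EuclideanSpace ℝ (Fin 3))) z.1 z.2, v z.1 z.2⟫)
      (Q : Set (ℝ × (EuclideanSpace ℝ (Fin 3)))) volume := by
    simp only [Pi.zero_apply, inner_zero_left]
    exact (locallyIntegrable_const (0 : ℝ)).locallyIntegrableOn _
  -- integrability of `v`, `|v|²` on `(0,T₀) × K`, good slices, the datum in `L²(K)`
  obtain ⟨hvK1, hvK2⟩ := integrableOn_cylinder_of_lintegral_sq_slab hmeas hsq hK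
  have hgood := ae_slice_aestronglyMeasurable_and_lintegral_ball_lt_top hmeas hsq
  have hgoodK : ∀ᵐ t ∂((volume : Measure ℝ).restrict (Ioo 0 T₀)),
      AEStronglyMeasurable (v t) (volume : Measure (EuclideanSpace ℝ (Fin 3))) ∧ ∫⁻ x in K, ‖v t x‖ₑ ^ 2 < ∞ := by
    filter_upwards [hgood] with t ht
    exact ⟨ht.1, (lintegral_mono_set (closedBall_subset_closedBall (Nat.le_ceil r))).trans_lt
      (ht.2 ⌈r⌉₊)⟩
  have hv₀K : ∫⁻ x in K, ‖v₀ x‖ₑ ^ 2 < ∞ :=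
    lintegral_datum_sq_lt_top hT₀ hgoodK hm₀ (hinit K hK)
  -- the sliced weighted energy `U` and its limit `L` at `0⁺`
  set U : ℝ → ℝ := fun t => ∫ x, ‖v t x‖ ^ 2 * ψ x with hU
  set L : ℝ := ∫ x, ‖v₀ x‖ ^ 2 * ψ x with hL
  have hWint : Integrable (fun z : ℝ × (EuclideanSpace ℝ (Fin 3)) => ‖uncurry v z‖ ^ 2 * ψ z.2)
      (((volume : Measure ℝ).restrict (Ioo 0 T₀)).prod (volume : Measure (EuclideanSpace ℝ (Fin 3)))) :=
    integrable_slab_mul hK hvK2 (hψ.continuous.comp continuous_snd) fun t x hx => hψK x hx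
  have hUint : IntegrableOn U (Ioo 0 T₀) volume := hWint.integral_prod_left
  have hlim : ∀ ε > 0, ∃ τ > 0, ∀ᵐ t ∂((volume : Measure ℝ).restrict (Ioo 0 τ)),
      |U t - L| ≤ ε := fun ε hε =>
    exists_ae_abs_integral_sq_mul_sub_le hT₀ hK hgoodK hm₀ hv₀K (hinit K hK) hψ.continuous
      hψ0 hψC hψK hε
  -- the intermediate horizons `τ < τ₁ < τ₁ + g < T₀`
  set g : ℝ := (T₀ - τ) / 3 with hg
  have hg0 : 0 < g := by rw [hg]; linarith
  set τ₁ : ℝ := τ + g with hτ₁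
  have hτ₁pos : 0 < τ₁ := by rw [hτ₁]; linarith
  have hττ₁ : τ < τ₁ := by rw [hτ₁]; linarith
  have hτ₁T : τ₁ + g < T₀ := by rw [hτ₁, hg]; linarith
  have hτ₁T' : τ₁ ≤ T₀ := by linarith
  -- bottom cut-offs at scale `δ m`
  set δ : ℕ → ℝ := fun m => τ₁ / (8 * ((m : ℝ) + 1)) with hδ
  have hδ0 : ∀ m, 0 < δ m := fun m => by positivity
  have hδle : ∀ m, δ m ≤ τ₁ / 8 := fun m => by
    show τ₁ / (8 * ((m : ℝ) + 1)) ≤ τ₁ / 8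
    exact div_le_div_of_nonneg_left hτ₁pos.le (by norm_num) (by nlinarith [m.cast_nonneg (α := ℝ)])
  have hδT : ∀ m, 3 * δ m ≤ T₀ := fun m => by linarith [hδle m]
  have hδlim : Tendsto δ atTop (𝓝 0) := by
    have h1 : Tendsto (fun m : ℕ => (m : ℝ) + 1) atTop atTop :=
      tendsto_atTop_add_const_right _ 1 tendsto_natCast_atTop_atTop
    have h2 : Tendsto (fun m : ℕ => 8 * ((m : ℝ) + 1)) atTop atTop :=
      h1.const_mul_atTop (by norm_num)
    exact tendsto_const_nhds.div_atTop h2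
  choose η ρ hηs hρc hηρ hη0 hη1 hη01 hρ0 hρsupp hρ1 using fun m => exists_smooth_time_cutoff (hδ0 m)
  have hηabs : ∀ m s, |η m s| ≤ 1 := fun m s => by
    rw [abs_le]; exact ⟨by linarith [(hη01 m s).1], (hη01 m s).2⟩
  have hρC : ∀ m, ∃ C, 0 ≤ C ∧ ∀ s, |ρ m s| ≤ C := fun m =>
    exists_abs_le_of_eq_zero_off_Ioo (hρc m) (hρsupp m)
  -- the top plateau `θ ≡ 1` on `[-1, τ₁]`, supported in `(-1 - g, τ₁ + g)`
  let θ : ContDiffBump ((τ₁ - 1) / 2 : ℝ) :=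
    ⟨(τ₁ + 1) / 2, (τ₁ + 1) / 2 + g, by linarith, by linarith⟩
  have hθrIn : θ.rIn = (τ₁ + 1) / 2 := rfl
  have hθrOut : θ.rOut = (τ₁ + 1) / 2 + g := rfl
  have hθ1 : ∀ t ∈ Icc (-1 : ℝ) τ₁, (θ : ℝ → ℝ) t = 1 := fun t ht =>
    θ.one_of_mem_closedBall (by
      rw [mem_closedBall, Real.dist_eq, hθrIn, abs_le]; constructor <;> linarith [ht.1, ht.2])
  have hθ0 : ∀ t, t ∉ Icc (-1 - g) (τ₁ + g) → (θ : ℝ → ℝ) t = 0 := fun t ht => by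
    by_contra hne
    have hmem : t ∈ support (θ : ℝ → ℝ) := hne
    rw [θ.support_eq, mem_ball, Real.dist_eq, hθrOut, abs_lt] at hmem
    exact ht ⟨by linarith [hmem.1], by linarith [hmem.2]⟩
  have hθderiv : ∀ t ∈ Ioo (-1 : ℝ) τ₁, deriv (θ : ℝ → ℝ) t = 0 := fun t ht => by
    have : (θ : ℝ → ℝ) =ᶠ[𝓝 t] fun _ => (1 : ℝ) := by
      filter_upwards [Ioo_mem_nhds ht.1 ht.2] with s hs using hθ1 s (Ioo_subset_Icc_self hs)
    rw [this.deriv_eq, deriv_const]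
  -- the test functions `ξ = θ ψ` and `ζ m = η m ξ`
  set ξ : ℝ → (EuclideanSpace ℝ (Fin 3)) → ℝ := fun t x => (θ : ℝ → ℝ) t * ψ x with hξ
  have hξtest : IsSpaceTimeTestOn (⊤ : Opens (ℝ × (EuclideanSpace ℝ (Fin 3)))) ξ :=
    (isSpaceTimeTestOn_prod_mul isOpen_univ isOpen_univ θ.contDiff (subset_univ _) hθ0 hψ hψcs
      (subset_univ _)).mono le_top
  set ζ : ℕ → ℝ → (EuclideanSpace ℝ (Fin 3)) → ℝ := fun m t x => η m t * ξ t x with hζ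
  have hζtest : ∀ m, IsSpaceTimeTestOn Q (ζ m) := by
    intro m
    have e : ζ m = fun t x => (η m t * (θ : ℝ → ℝ) t) * ψ x := by
      funext t x; simp only [hζ, hξ]; ring
    rw [e]
    refine isSpaceTimeTestOn_prod_mul isOpen_Ioo isOpen_ball ((hηs m).mul θ.contDiff)
      (a := δ m) (b := τ₁ + g) (Icc_subset_Ioo (hδ0 m) hτ₁T) ?_ hψ hψcs hψs
    intro t ht
    by_cases h1 : t ≤ δ m
    · rw [hη0 m t h1, zero_mul]
    · have : t ∉ Icc (-1 - g) (τ₁ + g) := fun h' =>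
        ht ⟨(not_le.1 h1).le, h'.2⟩
      rw [hθ0 t this, mul_zero]
  have hζ0 : ∀ m t x, 0 ≤ ζ m t x := fun m t x =>
    mul_nonneg (hη01 m t).1 (mul_nonneg (θ.nonneg) (hψ0 x))
  -- `R[ξ] = R₀` on `(0, 5T₀/8) × (EuclideanSpace ℝ (Fin 3))`
  have hRξ : ∀ z : ℝ × (EuclideanSpace ℝ (Fin 3)), z.1 ∈ Ioo (0 : ℝ) τ₁ →
      localEnergyRHS 1 0 v π ξ z = R₀ z := by
    rintro ⟨t, x⟩ ht
    have hθt : (θ : ℝ → ℝ) t = 1 := hθ1 t ⟨by linarith [ht.1], ht.2.le⟩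
    have htd : timeDeriv ξ t x = 0 := by
      simp only [timeDeriv, hξ]
      rw [deriv_mul_const ((θ.contDiff (n := (⊤ : ℕ∞))).differentiable (by simp)).differentiableAt,
        hθderiv t ⟨by linarith [ht.1], ht.2⟩, zero_mul]
    have hΔ : Δ (ξ t) x = (θ : ℝ → ℝ) t * Δ ψ x := by
      have := laplacian_fun_const_smul hψ2 ((θ : ℝ → ℝ) t) x
      simpa only [smul_eq_mul] using this
    have hgradξ : gradient (ξ t) x = (θ : ℝ → ℝ) t • gradient ψ x := by
      have := gradient_fun_const_smul (hψd x) ((θ : ℝ → ℝ) t)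
      simpa only [smul_eq_mul] using this
    simp only [localEnergyRHS, hR₀, htd, hΔ, hgradξ, hθt, Pi.zero_apply, inner_zero_left, one_mul,
      one_smul, zero_add, mul_zero, zero_mul, add_zero]
  -- integrability of the kernel term `ρ(t) |v|² ξ`
  have hI2 : ∀ m, Integrable (fun z : ℝ × (EuclideanSpace ℝ (Fin 3)) => ρ m z.1 * (‖v z.1 z.2‖ ^ 2 * ξ z.1 z.2))
      (volume : Measure (ℝ × (EuclideanSpace ℝ (Fin 3)))) := by
    intro m
    obtain ⟨C, -, hC⟩ := hρC m
    have hθb : ∀ s, |ρ m s * (θ : ℝ → ℝ) s| ≤ C := fun s => by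
      rw [abs_mul, abs_of_nonneg θ.nonneg]
      exact (mul_le_of_le_one_right (abs_nonneg _) θ.le_one).trans (hC s)
    have h1 : Integrable (fun z : ℝ × (EuclideanSpace ℝ (Fin 3)) => (ρ m z.1 * (θ : ℝ → ℝ) z.1) *
        (‖uncurry v z‖ ^ 2 * ψ z.2))
        (((volume : Measure ℝ).restrict (Ioo 0 T₀)).prod (volume : Measure (EuclideanSpace ℝ (Fin 3)))) :=
      integrable_time_mul hWint ((hρc m).mul θ.continuous) hθb
    rw [← volume_restrict_slab_eq] at h1
    have h1' : IntegrableOn (fun z : ℝ × (EuclideanSpace ℝ (Fin 3)) => (ρ m z.1 * (θ : ℝ → ℝ) z.1) *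
        (‖uncurry v z‖ ^ 2 * ψ z.2)) (Ioo 0 T₀ ×ˢ univ) volume := h1
    have h2 := h1'.integrable_of_forall_notMem_eq_zero (fun z hz => by
      have hz1 : z.1 ∉ Ioo (δ m) (3 * δ m) := fun h' =>
        hz ⟨⟨(hδ0 m).trans h'.1, h'.2.trans_le (hδT m)⟩, mem_univ _⟩
      rw [hρsupp m z.1 hz1, zero_mul, zero_mul])
    refine h2.congr (Eventually.of_forall fun z => ?_)
    simp only [hξ, uncurry]
    ring
  -- integrability of `R[ζ m]` and of `η R[ξ] = R[ζ m] - ρ |v|² ξ`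
  have hIR : ∀ m, Integrable (localEnergyRHS 1 0 v π (ζ m)) (volume : Measure (ℝ × (EuclideanSpace ℝ (Fin 3)))) :=
    fun m => hsuit.integrable_localEnergyRHS hu3' hfu (hζtest m)
  have hdec : ∀ m (z : ℝ × (EuclideanSpace ℝ (Fin 3))), localEnergyRHS 1 0 v π (ζ m) z =
      η m z.1 * localEnergyRHS 1 0 v π ξ z + ρ m z.1 * (‖v z.1 z.2‖ ^ 2 * ξ z.1 z.2) := by
    rintro m ⟨t, x⟩
    exact localEnergyRHS_mul_of_hasDerivAt (ν := 1) (f := 0) (u := v) (p := π) hξtest (hηρ m) t x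
  have hI1 : ∀ m, Integrable (fun z : ℝ × (EuclideanSpace ℝ (Fin 3)) => η m z.1 * localEnergyRHS 1 0 v π ξ z)
      (volume : Measure (ℝ × (EuclideanSpace ℝ (Fin 3)))) := by
    intro m
    refine ((hIR m).sub (hI2 m)).congr (Eventually.of_forall fun z => ?_)
    simp only [Pi.sub_apply, hdec m z]
    ring
  -- the kernel term is `∫ ρ U`
  have hker : ∀ m, ∀ s, 3 * δ m < s →
      ∫ z in {z : ℝ × (EuclideanSpace ℝ (Fin 3)) | z.1 < s}, ρ m z.1 * (‖v z.1 z.2‖ ^ 2 * ξ z.1 z.2) =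
        ∫ t in Ioo 0 T₀, ρ m t * U t := by
    intro m s hs
    -- the integrand vanishes for `t ≥ s` and equals `ρ(t) |v|² ψ` everywhere
    have hptw : ∀ z : ℝ × (EuclideanSpace ℝ (Fin 3)), ρ m z.1 * (‖v z.1 z.2‖ ^ 2 * ξ z.1 z.2) =
        ρ m z.1 * (‖uncurry v z‖ ^ 2 * ψ z.2) := by
      intro z
      by_cases hz : z.1 ∈ Ioo (δ m) (3 * δ m)
      · have hθz : (θ : ℝ → ℝ) z.1 = 1 :=
          hθ1 z.1 ⟨by linarith [hz.1, hδ0 m], by linarith [hz.2, hδle m, hτ₁pos]⟩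
        simp only [hξ, hθz, one_mul, uncurry]
      · rw [hρsupp m z.1 hz, zero_mul, zero_mul]
    rw [setIntegral_eq_integral_of_forall_compl_eq_zero (fun z hz => by
      have hz' : s ≤ z.1 := not_lt.1 hz
      have : z.1 ∉ Ioo (δ m) (3 * δ m) := fun h' => by linarith [h'.2]
      rw [hρsupp m z.1 this, zero_mul])]
    simp_rw [hptw]
    obtain ⟨C, -, hC⟩ := hρC m
    have hint : Integrable (fun z : ℝ × (EuclideanSpace ℝ (Fin 3)) => ρ m z.1 * (‖uncurry v z‖ ^ 2 * ψ z.2))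
        (((volume : Measure ℝ).restrict (Ioo 0 T₀)).prod (volume : Measure (EuclideanSpace ℝ (Fin 3)))) :=
      integrable_time_mul hWint (hρc m) hC
    have hzero : ∀ z : ℝ × (EuclideanSpace ℝ (Fin 3)), z ∉ Ioo 0 T₀ ×ˢ (univ : Set (EuclideanSpace ℝ (Fin 3))) →
        ρ m z.1 * (‖uncurry v z‖ ^ 2 * ψ z.2) = 0 := fun z hz => by
      have : z.1 ∉ Ioo (δ m) (3 * δ m) := fun h' =>
        hz ⟨⟨(hδ0 m).trans h'.1, h'.2.trans_le (hδT m)⟩, mem_univ _⟩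
      rw [hρsupp m z.1 this, zero_mul]
    rw [← setIntegral_eq_integral_of_forall_compl_eq_zero hzero, volume_restrict_slab_eq,
      integral_prod _ hint]
    refine setIntegral_congr_fun measurableSet_Ioo fun t _ => ?_
    simp only [hU, uncurry, ← integral_const_mul]
  -- the transport term is bounded by the flux over `(0,s) × B_r`
  have hflux : ∀ m, ∀ s ∈ Ioo (0 : ℝ) τ,
      ENNReal.ofReal (∫ z in {z : ℝ × (EuclideanSpace ℝ (Fin 3)) | z.1 < s}, η m z.1 * localEnergyRHS 1 0 v π ξ z) ≤
        ∫⁻ z in Ioo 0 s ×ˢ ball (0 : (EuclideanSpace ℝ (Fin 3))) r, ‖R₀ z‖ₑ := by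
    intro m s hs
    have hSm : MeasurableSet (Ioo 0 s ×ˢ ball (0 : (EuclideanSpace ℝ (Fin 3))) r) := measurableSet_Ioo.prod measurableSet_ball
    calc ENNReal.ofReal (∫ z in {z : ℝ × (EuclideanSpace ℝ (Fin 3)) | z.1 < s}, η m z.1 * localEnergyRHS 1 0 v π ξ z)
        ≤ ‖∫ z in {z : ℝ × (EuclideanSpace ℝ (Fin 3)) | z.1 < s}, η m z.1 * localEnergyRHS 1 0 v π ξ z‖ₑ := by
          rw [Real.enorm_eq_ofReal_abs]
          exact ENNReal.ofReal_le_ofReal (le_abs_self _)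
      _ ≤ ∫⁻ z in {z : ℝ × (EuclideanSpace ℝ (Fin 3)) | z.1 < s}, ‖η m z.1 * localEnergyRHS 1 0 v π ξ z‖ₑ :=
          enorm_integral_le_lintegral_enorm _
      _ ≤ ∫⁻ z in {z : ℝ × (EuclideanSpace ℝ (Fin 3)) | z.1 < s},
            (Ioo 0 s ×ˢ ball (0 : (EuclideanSpace ℝ (Fin 3))) r).indicator (fun z => ‖R₀ z‖ₑ) z := by
          refine lintegral_mono_ae ?_
          filter_upwards [ae_restrict_mem (measurableSet_lt measurable_fst measurable_const)]
            with z hz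
          have hzs : z.1 < s := hz
          by_cases h1 : z.1 ≤ δ m
          · rw [hη0 m z.1 h1, zero_mul, enorm_zero]
            exact zero_le
          · have hz0 : 0 < z.1 := (hδ0 m).trans (not_le.1 h1)
            have hzI : z.1 ∈ Ioo (0 : ℝ) τ₁ := ⟨hz0, by linarith [hs.2, hzs, hττ₁]⟩
            rw [hRξ z hzI]
            by_cases h2 : z.2 ∈ ball (0 : (EuclideanSpace ℝ (Fin 3))) r
            · rw [indicator_of_mem (show z ∈ Ioo 0 s ×ˢ ball (0 : (EuclideanSpace ℝ (Fin 3))) r from ⟨⟨hz0, hzs⟩, h2⟩),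
                enorm_mul]
              calc ‖η m z.1‖ₑ * ‖R₀ z‖ₑ ≤ 1 * ‖R₀ z‖ₑ := by
                    gcongr
                    rw [Real.enorm_eq_ofReal_abs, ← ENNReal.ofReal_one]
                    exact ENNReal.ofReal_le_ofReal (hηabs m z.1)
                _ = ‖R₀ z‖ₑ := one_mul _
            · rw [hR₀0 z h2, mul_zero, enorm_zero]
              exact zero_le
      _ ≤ ∫⁻ z, (Ioo 0 s ×ˢ ball (0 : (EuclideanSpace ℝ (Fin 3))) r).indicator (fun z => ‖R₀ z‖ₑ) z :=
          lintegral_mono' Measure.restrict_le_self le_rfl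
      _ = ∫⁻ z in Ioo 0 s ×ˢ ball (0 : (EuclideanSpace ℝ (Fin 3))) r, ‖R₀ z‖ₑ := lintegral_indicator hSm _
  -- the sliced inequality for each `m`
  have hslice : ∀ m, ∀ᵐ s ∂(volume : Measure ℝ), s ∈ Ioo (3 * δ m) τ →
      (∫⁻ x, ‖v s x‖ₑ ^ 2 * ENNReal.ofReal (ψ x)) +
          2 * ∫⁻ z in Ico (3 * δ m) s ×ˢ ball (0 : (EuclideanSpace ℝ (Fin 3))) r,
            ENNReal.ofReal (frobeniusNormSq (G z.1 z.2)) * ENNReal.ofReal (ψ z.2) ≤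
        ENNReal.ofReal (∫ t in Ioo 0 T₀, ρ m t * U t) +
          ∫⁻ z in Ioo 0 s ×ˢ ball (0 : (EuclideanSpace ℝ (Fin 3))) r, ‖R₀ z‖ₑ := by
    intro m
    filter_upwards [hsuit.ae_localEnergy_slice_ennreal hGQ hu3' hfu (hζtest m) (hζ0 m)
      zero_le_one] with s hs hsI
    have hs0 : 0 < s := lt_trans (by linarith [hδ0 m]) hsI.1
    have hζs : ∀ x, ζ m s x = ψ x := fun x => by
      simp only [hζ, hξ]
      rw [hη1 m s hsI.1.le, hθ1 s ⟨by linarith, by linarith [hsI.2, hττ₁]⟩, one_mul, one_mul]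
    -- the dissipation on `[3δ_m, s) × B_r`, where `ζ_m = ψ`
    have hgrad : 2 * ∫⁻ z in Ico (3 * δ m) s ×ˢ ball (0 : (EuclideanSpace ℝ (Fin 3))) r,
          ENNReal.ofReal (frobeniusNormSq (G z.1 z.2)) * ENNReal.ofReal (ψ z.2) ≤
        ENNReal.ofReal (2 * 1) * ∫⁻ z in {z : ℝ × (EuclideanSpace ℝ (Fin 3)) | z.1 < s},
          ENNReal.ofReal (frobeniusNormSq (G z.1 z.2)) * ENNReal.ofReal (ζ m z.1 z.2) := by
      rw [mul_one, ENNReal.ofReal_ofNat]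
      refine mul_le_mul' le_rfl ?_
      have hSm : MeasurableSet (Ico (3 * δ m) s ×ˢ ball (0 : (EuclideanSpace ℝ (Fin 3))) r) :=
        measurableSet_Ico.prod measurableSet_ball
      calc ∫⁻ z in Ico (3 * δ m) s ×ˢ ball (0 : (EuclideanSpace ℝ (Fin 3))) r,
            ENNReal.ofReal (frobeniusNormSq (G z.1 z.2)) * ENNReal.ofReal (ψ z.2)
          = ∫⁻ z in Ico (3 * δ m) s ×ˢ ball (0 : (EuclideanSpace ℝ (Fin 3))) r,
              ENNReal.ofReal (frobeniusNormSq (G z.1 z.2)) * ENNReal.ofReal (ζ m z.1 z.2) := by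
            refine setLIntegral_congr_fun hSm fun z hz => ?_
            have hz1 : z.1 ∈ Ico (3 * δ m) s := hz.1
            have hζz : ζ m z.1 z.2 = ψ z.2 := by
              simp only [hζ, hξ]
              rw [hη1 m z.1 hz1.1, hθ1 z.1 ⟨by linarith [hz1.1, hδ0 m], by linarith [hz1.2, hsI.2, hττ₁]⟩,
                one_mul, one_mul]
            rw [hζz]
        _ ≤ ∫⁻ z in {z : ℝ × (EuclideanSpace ℝ (Fin 3)) | z.1 < s},
              ENNReal.ofReal (frobeniusNormSq (G z.1 z.2)) * ENNReal.ofReal (ζ m z.1 z.2) :=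
            lintegral_mono_set fun z hz => hz.1.2
    have hLHS : (∫⁻ x, ‖v s x‖ₑ ^ 2 * ENNReal.ofReal (ψ x)) +
          2 * ∫⁻ z in Ico (3 * δ m) s ×ˢ ball (0 : (EuclideanSpace ℝ (Fin 3))) r,
            ENNReal.ofReal (frobeniusNormSq (G z.1 z.2)) * ENNReal.ofReal (ψ z.2) ≤
        ENNReal.ofReal (∫ z in {z : ℝ × (EuclideanSpace ℝ (Fin 3)) | z.1 < s}, localEnergyRHS 1 0 v π (ζ m) z) := by
      refine le_trans ?_ hs
      exact add_le_add (le_of_eq (lintegral_congr fun x => by rw [hζs x])) hgrad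
    refine hLHS.trans ?_
    have hsplit : ∫ z in {z : ℝ × (EuclideanSpace ℝ (Fin 3)) | z.1 < s}, localEnergyRHS 1 0 v π (ζ m) z =
        (∫ z in {z : ℝ × (EuclideanSpace ℝ (Fin 3)) | z.1 < s}, η m z.1 * localEnergyRHS 1 0 v π ξ z) +
          ∫ z in {z : ℝ × (EuclideanSpace ℝ (Fin 3)) | z.1 < s}, ρ m z.1 * (‖v z.1 z.2‖ ^ 2 * ξ z.1 z.2) := by
      rw [← integral_add (hI1 m).integrableOn (hI2 m).integrableOn]
      exact integral_congr_ae (Eventually.of_forall fun z => hdec m z)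
    rw [hsplit, hker m s hsI.1, add_comm]
    exact (ENNReal.ofReal_add_le).trans (add_le_add le_rfl (hflux m s ⟨hs0, hsI.2⟩))
  -- assemble over `m` and let `m → ∞`
  have hall := ae_all_iff.2 hslice
  have hB : Tendsto (fun m => ∫ t in Ioo 0 T₀, ρ m t * U t) atTop (𝓝 L) :=
    tendsto_setIntegral_mul_of_ae_tendsto hUint hlim hδlim hδ0 hδT hρc hρ0 hρsupp hρ1
  have hLeq : ENNReal.ofReal L = ∫⁻ x, ‖v₀ x‖ₑ ^ 2 * ENNReal.ofReal (ψ x) := by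
    have hsq0 : Integrable (fun x => ‖v₀ x‖ ^ 2) ((volume : Measure (EuclideanSpace ℝ (Fin 3))).restrict K) := by
      have hm : MemLp v₀ 2 ((volume : Measure (EuclideanSpace ℝ (Fin 3))).restrict K) :=
        memLp_two_restrict_of_lintegral_lt_top hm₀ hv₀K
      exact (memLp_two_iff_integrable_sq_norm hm.1).1 hm
    have hψabs : ∀ x, ‖ψ x‖ ≤ Cψ := hCψ
    have hintK : IntegrableOn (fun x => ‖v₀ x‖ ^ 2 * ψ x) K volume :=
      hsq0.mul_bdd hψ.continuous.aestronglyMeasurable (Eventually.of_forall hψabs)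
    have hint : Integrable (fun x => ‖v₀ x‖ ^ 2 * ψ x) (volume : Measure (EuclideanSpace ℝ (Fin 3))) :=
      hintK.integrable_of_forall_notMem_eq_zero fun x hx => by rw [hψK x hx, mul_zero]
    rw [hL, ofReal_integral_eq_lintegral_ofReal hint
      (Eventually.of_forall fun x => mul_nonneg (sq_nonneg _) (hψ0 x))]
    refine lintegral_congr fun x => ?_
    rw [ENNReal.ofReal_mul (sq_nonneg _), ENNReal.ofReal_pow (norm_nonneg _), ofReal_norm]
  rw [ae_restrict_iff' measurableSet_Ioo]
  filter_upwards [hall] with s hs hsI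
  have hev : ∀ᶠ m in atTop, 3 * δ m < s := by
    have h3 : Tendsto (fun m => 3 * δ m) atTop (𝓝 0) := by simpa using hδlim.const_mul 3
    exact (tendsto_order.1 h3).2 _ hsI.1
  have hlimit : Tendsto (fun m => ENNReal.ofReal (∫ t in Ioo 0 T₀, ρ m t * U t) +
      ∫⁻ z in Ioo 0 s ×ˢ ball (0 : (EuclideanSpace ℝ (Fin 3))) r, ‖R₀ z‖ₑ) atTop
      (𝓝 (ENNReal.ofReal L + ∫⁻ z in Ioo 0 s ×ˢ ball (0 : (EuclideanSpace ℝ (Fin 3))) r, ‖R₀ z‖ₑ)) :=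
    ((ENNReal.continuous_ofReal.tendsto L).comp hB).add tendsto_const_nhds
  -- the dissipation integrals `b m` increase to the one over `(0,s) × B_r`
  set b : ℕ → ℝ≥0∞ := fun m => ∫⁻ z in Ico (3 * δ m) s ×ˢ ball (0 : (EuclideanSpace ℝ (Fin 3))) r,
    ENNReal.ofReal (frobeniusNormSq (G z.1 z.2)) * ENNReal.ofReal (ψ z.2) with hb
  have hδanti : ∀ m m' : ℕ, m ≤ m' → δ m' ≤ δ m := fun m m' hmm' => by
    show τ₁ / (8 * ((m' : ℝ) + 1)) ≤ τ₁ / (8 * ((m : ℝ) + 1))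
    exact div_le_div_of_nonneg_left hτ₁pos.le (by positivity)
      (by have : (m : ℝ) ≤ m' := Nat.cast_le.2 hmm'; nlinarith)
  have hbmono : Monotone b := fun m m' hmm' =>
    lintegral_mono_set (prod_mono (Ico_subset_Ico_left (by linarith [hδanti m m' hmm'])) Subset.rfl)
  have hUnion : (⋃ m, Ico (3 * δ m) s ×ˢ ball (0 : (EuclideanSpace ℝ (Fin 3))) r) =
      Ioo 0 s ×ˢ ball (0 : (EuclideanSpace ℝ (Fin 3))) r := by
    ext z
    simp only [mem_iUnion, mem_prod, mem_Ico, mem_Ioo]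
    constructor
    · rintro ⟨m, ⟨h1, h2⟩, h3⟩
      exact ⟨⟨lt_of_lt_of_le (by linarith [hδ0 m]) h1, h2⟩, h3⟩
    · rintro ⟨⟨h1, h2⟩, h3⟩
      have h3δ : Tendsto (fun m => 3 * δ m) atTop (𝓝 0) := by simpa using hδlim.const_mul 3
      obtain ⟨m, hm⟩ := ((tendsto_order.1 h3δ).2 _ h1).exists
      exact ⟨m, ⟨hm.le, h2⟩, h3⟩
  have hdir : Directed (· ⊆ ·) fun m => Ico (3 * δ m) s ×ˢ ball (0 : (EuclideanSpace ℝ (Fin 3))) r :=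
    Monotone.directed_le fun m m' hmm' =>
      prod_mono (Ico_subset_Ico_left (by linarith [hδanti m m' hmm'])) Subset.rfl
  have hsup : ∫⁻ z in Ioo 0 s ×ˢ ball (0 : (EuclideanSpace ℝ (Fin 3))) r,
      ENNReal.ofReal (frobeniusNormSq (G z.1 z.2)) * ENNReal.ofReal (ψ z.2) = ⨆ m, b m := by
    rw [← hUnion]
    exact setLIntegral_iUnion_of_directed _ hdir
  rw [hsup, ENNReal.mul_iSup, ENNReal.add_iSup]
  refine iSup_le fun m₀ => ?_
  have key : ∀ᶠ m in atTop, (∫⁻ x, ‖v s x‖ₑ ^ 2 * ENNReal.ofReal (ψ x)) + 2 * b m₀ ≤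
      ENNReal.ofReal (∫ t in Ioo 0 T₀, ρ m t * U t) +
        ∫⁻ z in Ioo 0 s ×ˢ ball (0 : (EuclideanSpace ℝ (Fin 3))) r, ‖R₀ z‖ₑ := by
    filter_upwards [hev, eventually_ge_atTop m₀] with m hm hmm₀
    exact (add_le_add le_rfl (mul_le_mul' le_rfl (hbmono hmm₀))).trans (hs m ⟨hm, hsI.2⟩)
  have := ge_of_tendsto hlimit key
  rwa [hLeq] at this

end JiaSverak2014

/-- **The local energy inequality of a local Leray solution on a slab from the initial time,
with the dissipation, at a.e. slice** (Seregin 2014, Remark B.3, (B.1.10) with `t₀ = 0`, for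
Lemarié-Rieusset's class of Def. 14.1 on `(0,T) × ℝ³`; the global-class twin is
`IsLocalLeraySolution.ae_lintegral_sq_mul_add_grad_le_datum_add`). Let `(v, π)` be a local
Leray solution on `(0,T) × ℝ³` (`ν = 1`) with measurable datum `v₀`, `G` a weak spatial gradient
of `v` on the slab, `0 < T₀ ≤ T`, and `ψ ≥ 0` smooth with `tsupport ψ ⊆ B_r`. Then for a.e.
`s ∈ (0, T₀)`,
`∫ |v(s)|² ψ + 2 ∫∫_{(0,s)×B_r} |G|² ψ ≤ ∫ |v₀|² ψ + ∫∫_{(0,s)×B_r} | |v|² Δψ + (|v|² + 2π) v·∇ψ |`.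
(This is the starting point of Jia–Šverák 2014, Lemma 3.1 and of the perturbed local energy
inequality in the proof of Thm. 3.1, p. 8, for solutions given on a slab only.)
[cite: Seregin2014Notes, App. B Remark B.3 (B.1.10); JiaSverak2014 §3 proof of Thm. 3.1 (arXiv p. 8)] -/
theorem IsLocalLeraySolutionOn.ae_lintegral_sq_mul_add_grad_le_datum_add
    {T : ℝ} {v₀ : (EuclideanSpace ℝ (Fin 3)) → (EuclideanSpace ℝ (Fin 3))}
    {v : ℝ → (EuclideanSpace ℝ (Fin 3)) → (EuclideanSpace ℝ (Fin 3))} {π : ℝ → (EuclideanSpace ℝ (Fin 3)) → ℝ}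
    (h : IsLocalLeraySolutionOn T 1 v₀ v π) (hm₀ : AEStronglyMeasurable v₀ volume)
    {G : ℝ → (EuclideanSpace ℝ (Fin 3)) → (EuclideanSpace ℝ (Fin 3)) →L[ℝ] (EuclideanSpace ℝ (Fin 3))}
    (hG : HasWeakSpatialGradientOn (slab (EuclideanSpace ℝ (Fin 3)) (Ioo 0 T) isOpen_Ioo) v G)
    {r T₀ : ℝ} (hT₀ : 0 < T₀) (hT₀T : T₀ ≤ T)
    {ψ : (EuclideanSpace ℝ (Fin 3)) → ℝ} (hψ : ContDiff ℝ (⊤ : ℕ∞) ψ) (hψs : tsupport ψ ⊆ ball 0 r)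
    (hψ0 : ∀ x, 0 ≤ ψ x) :
    ∀ᵐ s ∂(volume.restrict (Ioo 0 T₀)),
      (∫⁻ x, ‖v s x‖ₑ ^ 2 * ENNReal.ofReal (ψ x)) +
          2 * ∫⁻ z in Ioo 0 s ×ˢ ball (0 : (EuclideanSpace ℝ (Fin 3))) r,
            ENNReal.ofReal (frobeniusNormSq (G z.1 z.2)) * ENNReal.ofReal (ψ z.2) ≤
        (∫⁻ x, ‖v₀ x‖ₑ ^ 2 * ENNReal.ofReal (ψ x)) +
        ∫⁻ z in Ioo 0 s ×ˢ ball (0 : (EuclideanSpace ℝ (Fin 3))) r,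
          ‖‖v z.1 z.2‖ ^ 2 * Δ ψ z.2 +
            (‖v z.1 z.2‖ ^ 2 + 2 * π z.1 z.2) * ⟪v z.1 z.2, gradient ψ z.2⟫‖ₑ := by
  have hI : Ioo (0 : ℝ) T₀ ⊆ Ioo 0 T := Ioo_subset_Ioo_right hT₀T
  -- the cylinder `Q = (0,T₀) × B_r` lies in the slab
  have hQle : (⟨Ioo 0 T₀ ×ˢ ball (0 : (EuclideanSpace ℝ (Fin 3))) r, isOpen_Ioo.prod isOpen_ball⟩ :
      Opens (ℝ × (EuclideanSpace ℝ (Fin 3)))) ≤ slab (EuclideanSpace ℝ (Fin 3)) (Ioo 0 T) isOpen_Ioo :=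
    fun z hz => mem_slab.2 (hI (show z ∈ Ioo (0 : ℝ) T₀ ×ˢ ball (0 : (EuclideanSpace ℝ (Fin 3))) r from hz).1)
  have hmeas : AEStronglyMeasurable (uncurry v)
      ((volume : Measure (ℝ × (EuclideanSpace ℝ (Fin 3)))).restrict (Ioo 0 T₀ ×ˢ univ)) :=
    h.aestronglyMeasurable.mono_measure (Measure.restrict_mono (Set.prod_mono hI Subset.rfl) le_rfl)
  have hsq : ∀ K' : Set (EuclideanSpace ℝ (Fin 3)), IsCompact K' →
      ∫⁻ z in Ioo 0 T₀ ×ˢ K', ‖uncurry v z‖ₑ ^ 2 < ∞ := fun K' hK' =>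
    lt_of_le_of_lt (lintegral_mono_set (Set.prod_mono hI Subset.rfl)) (h.sqIntegrable K' hK')
  -- `|v|³ ∈ L¹((0,T₀) × B_r)` from the slab cubic integrability
  have hu3 : IntegrableOn (fun z : ℝ × (EuclideanSpace ℝ (Fin 3)) => ‖v z.1 z.2‖ ^ 3)
      (Ioo 0 T₀ ×ˢ ball (0 : (EuclideanSpace ℝ (Fin 3))) r) volume := by
    refine IntegrableOn.mono_set ?_ (Set.prod_mono hI Subset.rfl)
    have hmeas3 : AEStronglyMeasurable (fun z : ℝ × (EuclideanSpace ℝ (Fin 3)) => ‖v z.1 z.2‖ ^ 3)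
        (volume.restrict (Ioo (0 : ℝ) T ×ˢ ball (0 : (EuclideanSpace ℝ (Fin 3))) r)) := by
      have h1 : AEStronglyMeasurable (uncurry v)
          (volume.restrict (Ioo (0 : ℝ) T ×ˢ ball (0 : (EuclideanSpace ℝ (Fin 3))) r)) :=
        h.aestronglyMeasurable.mono_measure
          (Measure.restrict_mono (Set.prod_mono Subset.rfl (subset_univ _)) le_rfl)
      exact h1.norm.pow 3
    refine ⟨hmeas3, ?_⟩
    rw [hasFiniteIntegral_iff_enorm]
    refine lt_of_le_of_lt (lintegral_mono fun z => le_of_eq ?_) (h.lintegral_cube_box_lt_top 0 r)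
    rw [Real.enorm_eq_ofReal (pow_nonneg (norm_nonneg _) 3), ← ofReal_norm,
      ENNReal.ofReal_pow (norm_nonneg _)]
  -- the horizons `τ_k = T₀ - T₀/(k+2) ↑ T₀`
  set τ : ℕ → ℝ := fun k => T₀ - T₀ / ((k : ℝ) + 2) with hτ
  have hτlt : ∀ k, τ k < T₀ := fun k => by
    have : 0 < T₀ / ((k : ℝ) + 2) := by positivity
    show T₀ - T₀ / ((k : ℝ) + 2) < T₀
    linarith
  have hτ0 : ∀ k, 0 < τ k := fun k => by
    have h2 : T₀ / ((k : ℝ) + 2) ≤ T₀ / 2 :=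
      div_le_div_of_nonneg_left hT₀.le (by norm_num) (by linarith [k.cast_nonneg (α := ℝ)])
    show 0 < T₀ - T₀ / ((k : ℝ) + 2)
    linarith
  have hk : ∀ k, ∀ᵐ s ∂(volume : Measure ℝ), s ∈ Ioo 0 (τ k) →
      (∫⁻ x, ‖v s x‖ₑ ^ 2 * ENNReal.ofReal (ψ x)) +
          2 * ∫⁻ z in Ioo 0 s ×ˢ ball (0 : (EuclideanSpace ℝ (Fin 3))) r,
            ENNReal.ofReal (frobeniusNormSq (G z.1 z.2)) * ENNReal.ofReal (ψ z.2) ≤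
        (∫⁻ x, ‖v₀ x‖ₑ ^ 2 * ENNReal.ofReal (ψ x)) +
        ∫⁻ z in Ioo 0 s ×ˢ ball (0 : (EuclideanSpace ℝ (Fin 3))) r,
          ‖‖v z.1 z.2‖ ^ 2 * Δ ψ z.2 +
            (‖v z.1 z.2‖ ^ 2 + 2 * π z.1 z.2) * ⟪v z.1 z.2, gradient ψ z.2⟫‖ₑ := fun k =>
    (ae_restrict_iff' measurableSet_Ioo).1
      (JiaSverak2014.ae_lintegral_sq_mul_add_grad_le_datum_add_of_suitable hT₀ hm₀
        (h.suitable.of_le hQle) (hG.mono hQle) hmeas hsq h.initial hu3 hψ hψs hψ0 (hτ0 k) (hτlt k))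
  rw [ae_restrict_iff' measurableSet_Ioo]
  filter_upwards [ae_all_iff.2 hk] with s hs hsI
  -- an horizon beyond `s`
  obtain ⟨n, hn⟩ := exists_nat_gt (T₀ / (T₀ - s))
  have hsT : 0 < T₀ - s := by linarith [hsI.2]
  have h1 : T₀ / (T₀ - s) < (n : ℝ) + 2 := by linarith
  have h2 : T₀ < ((n : ℝ) + 2) * (T₀ - s) := (div_lt_iff₀ hsT).1 h1
  have h3 : T₀ / ((n : ℝ) + 2) < T₀ - s := by
    rw [div_lt_iff₀ (by positivity)]
    linarith
  exact hs n ⟨hsI.1, show s < T₀ - T₀ / ((n : ℝ) + 2) by linarith⟩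

end Literature.Analysis.FluidPDE

end
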